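import Summits.QuantumFields.BalabanUV.T4Continuum.Support.ShellMeasureDecayKernelComp

/-!
# `T4Continuum.ShellMeasureDecayKernelCompCells` — ROW S122 f2: THE CELL BLOCKS OF A PRODUCT OF REAL OPERATORS ARE THE KERNEL
# COMPOSITE OF THE FACTORS' CELL BLOCKS (J3's `toEuclideanCLM` block currency), HENCE E6 ROWS OF CELL BLOCKS MULTIPLY
(cell `pub-balaban`, sub-cell `t4`, spine estimate NE7c (node U5b); NE7c ROUND-2 crew, unit `b2b-balaban-t4-ne7c-formalise-leaf-06` gen 10;
post-v6 ESTIMATE LANE, row S122 = J7 (owner GO R-ne7cp1-g37-11) file 2 — the bridge between f1 `ShellMeasureDecayKernelComp.compKer_decay`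
(E6 rows closed under `compKer`) and ROW J3's currency (leaf-02-g13 `ShellMeasureDecayRowsLevelOpCells.decayRow_levelOp_cells(_cov)`: the block
`toEuclideanCLM ((of fun p q => [cellOf p = c][cellOf q = b′]·(G e_q)_p).map ofReal)` of a REAL linear map `G` between the cells of a labelling);
ADDITIVE — imports f1 ONLY (Mathlib's `Matrix.toEuclideanCLM` through it); [folklore]; data defs `blockMat`, `cellBlock` (J3's inlined block, named),
0 `def … : Prop`, 0 sorry, 0 citation tags; touches NO host, moves NO census row)

HONEST FRAMING.  Finite four-torus programme, rung (B)+1 only — NOT infinite volume, NOT a mass gap, NOT the Clay problem, NOT summit progress.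
NE7c (`T4IndicatorShell.ShellWeightBound`) is NOT PRINTED in [Balaban 1983–89] and NOT PROVED; «NE7c ⇐ the named binders» (THE ONE CALL of record
v4 p238484, 84 displayed [T]; v5 63).  LINEAR-ALGEBRA bookkeeping on OUR side (finite sums, a labelling of a finite index set into cells); nothing
about Bałaban's minimisers, propagators or kernels is computed, asserted, cited or discharged; which operators node O identifies as `G`, `H` (e.g. the
(103)-map `H₁ = G₁𝔓*`) is NOT decided here.  HONEST DEPENDENCY (cell): continuum YM on T⁴ ⇐ BetaPertH ∧ nine spine estimates (0/9 proved);
BetaPertH ⇐ (D1) ∧ (D4) ∧ CAP+tail; G-an2-4 gates asym, D1 and NE2/3/4.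

CONTENT (kernel, 0 sorry).  §1 `blockMat lab G c b` (J3's two-set block matrix with the sets = label classes), `apply_eq_sum_single` (`(G u)_p =
Σ_r u_r·(G e_r)_p`), **`sum_blockMat_mul`** (`Σ_c blockMat G e c · blockMat H c b = blockMat (G ∘ H) e b` — the label classes PARTITION the index
set, so the middle indicator resolves the identity).  §2 `cellBlock lab G c b := toEuclideanCLM ((blockMat lab G c b).map ofReal)` (LITERALLY J3's
block when `lab := cellOf ∘ Prod.fst`), **`compKer_cellBlock`** (`cellBlock G ⋆ cellBlock H = cellBlock (G ∘ H)`, by `toEuclideanCLM`'s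
multiplicativity).  §3 **`cellBlock_comp_decay`**: E6 rows for the cell blocks of `G` and of `H` (rates `δ₁, δ₂`, constants `c₁, c₂`, cell positions
`pos : K → 𝔖`, `dis ≥ 0` with the triangle inequality, reduced-rate uniform cell sum `≤ M`) ⟹ THE SAME ROW SHAPE for the cell blocks of `G ∘ H`
with constant `c₁c₂M` at any rate `δ ≤ min δ₁ δ₂` — f1's `compKer_decay` BY NAME through §2.  USE: J3 gives the row for `(levelOp)⁻¹`'s blocks
(`pos := ctrU … (zc ·)`, `dis := sdist`, clauses by `sdist_nonneg`∕`sdist_triangle_torus`); a finite-range factor gets its row from f1's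
`decay_of_finite_range`; §3 then types the E2∕E3 composite's row.  §4 the SCALAR bridge (`scalarKer A c b := A c b • id`, `norm_scalarKer`,
`compKer_scalarKer : scalarKer A ⋆ scalarKer B = scalarKer (A * B)`, **`matrix_mul_decay`**: E6 rows of MATRICES multiply on any placed index
sets — the `Beta/`∕`WRS` matrix currency, e.g. [B9] (3.126)'s `H = A⁻¹Q*(QA⁻¹Q*)⁻¹` read factor by factor).  NOTHING in the countdown moves.
-/

noncomputable section

open scoped BigOperators

namespace Summit.QuantumFields.BalabanUV.T4Continuum.ShellMeasureDecayKernelCompCells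

open Summit.QuantumFields.BalabanUV.T4Continuum.ShellMeasureDecayKernelSums (compKer)
open Summit.QuantumFields.BalabanUV.T4Continuum.ShellMeasureDecayKernelComp (compKer_decay)

variable {X : Type*} [Fintype X] [DecidableEq X] {K : Type*} [Fintype K] [DecidableEq K]

/-! ## §1 Block matrices of a real linear map between label classes multiply -/

/-- **The block matrix** of a real linear map `G` between the label classes `c` (rows) and `b` (columns) of `lab : X → K`:
`blockMat lab G c b p q = [lab p = c][lab q = b]·(G e_q)_p` (J3's two-set block with the sets = label classes; DATA). [folklore] -/
def blockMat (lab : X → K) (G : (X → ℝ) →ₗ[ℝ] (X → ℝ)) (c b : K) : Matrix X X ℝ :=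
  Matrix.of fun p q => if lab p = c ∧ lab q = b then G (Pi.single q 1) p else 0

omit [Fintype X] [Fintype K] in
/-- [folklore] -/
theorem blockMat_apply (lab : X → K) (G : (X → ℝ) →ₗ[ℝ] (X → ℝ)) (c b : K) (p q : X) :
    blockMat lab G c b p q = if lab p = c ∧ lab q = b then G (Pi.single q 1) p else 0 := rfl

omit [Fintype K] [DecidableEq K] in
/-- A real linear map in coordinates: `(G u)_p = Σ_r u_r·(G e_r)_p`. [folklore] -/
theorem apply_eq_sum_single (G : (X → ℝ) →ₗ[ℝ] (X → ℝ)) (u : X → ℝ) (p : X) :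
    G u p = ∑ r, u r * G (Pi.single r 1) p := by
  have hu : u = ∑ r, u r • (Pi.single r (1 : ℝ) : X → ℝ) := by
    ext j
    simp only [Finset.sum_apply, Pi.smul_apply, Pi.single_apply, smul_eq_mul, mul_ite, mul_one, mul_zero,
      Finset.sum_ite_eq, Finset.mem_univ, if_true]
  conv_lhs => rw [hu]
  simp only [map_sum, map_smul, Finset.sum_apply, Pi.smul_apply, smul_eq_mul]

/-- **BLOCK MATRICES MULTIPLY**: `Σ_c blockMat G e c · blockMat H c b = blockMat (G ∘ H) e b` — the label classes partition `X`, so the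
middle indicator `[lab r = c]` summed over `c` resolves the identity. [folklore] -/
theorem sum_blockMat_mul (lab : X → K) (G H : (X → ℝ) →ₗ[ℝ] (X → ℝ)) (e b : K) :
    ∑ c, blockMat lab G e c * blockMat lab H c b = blockMat lab (G ∘ₗ H) e b := by
  ext p q
  rw [Matrix.sum_apply, blockMat_apply, LinearMap.comp_apply]
  simp only [Matrix.mul_apply, blockMat_apply]
  have hswap : ∑ c, ∑ r, (if lab p = e ∧ lab r = c then G (Pi.single r 1) p else 0) *
        (if lab r = c ∧ lab q = b then H (Pi.single q 1) r else 0) =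
      ∑ r, (if lab p = e ∧ lab q = b then H (Pi.single q 1) r * G (Pi.single r 1) p else 0) := by
    rw [Finset.sum_comm]
    refine Finset.sum_congr rfl fun r _ => ?_
    have hterm : ∀ c, (if lab p = e ∧ lab r = c then G (Pi.single r 1) p else 0) *
        (if lab r = c ∧ lab q = b then H (Pi.single q 1) r else 0) =
        if lab r = c then (if lab p = e ∧ lab q = b then H (Pi.single q 1) r * G (Pi.single r 1) p else 0) else 0 := by
      intro c
      by_cases hrc : lab r = c
      · by_cases hpe : lab p = e
        · by_cases hqb : lab q = b
          · simp [hrc, hpe, hqb, mul_comm]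
          · simp [hrc, hqb]
        · simp [hrc, hpe]
      · simp [hrc]
    simp_rw [hterm]
    rw [Finset.sum_ite_eq Finset.univ (lab r)]
    simp
  rw [hswap]
  by_cases hcond : lab p = e ∧ lab q = b
  · simp only [hcond, and_self, if_true]
    rw [apply_eq_sum_single G (H (Pi.single q 1)) p]
  · simp only [hcond, if_false, Finset.sum_const_zero]

/-! ## §2 The complexified cell blocks on `EuclideanSpace ℂ X` compose as kernels -/

/-- **The cell block** of a real linear map as a continuous ℂ-linear map on the ℓ²-fibre `EuclideanSpace ℂ X` (LITERALLY J3's block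
`toEuclideanCLM ((of fun p q => [cellOf p = c][cellOf q = b]·(G e_q)_p).map ofReal)` for `lab := cellOf ∘ Prod.fst`; DATA). [folklore] -/
def cellBlock (lab : X → K) (G : (X → ℝ) →ₗ[ℝ] (X → ℝ)) (c b : K) : EuclideanSpace ℂ X →L[ℂ] EuclideanSpace ℂ X :=
  Matrix.toEuclideanCLM (n := X) (𝕜 := ℂ) ((blockMat lab G c b).map Complex.ofReal)

/-- **CELL BLOCKS MULTIPLY AS KERNELS**: `cellBlock G ⋆ cellBlock H = cellBlock (G ∘ H)` (`compKer` of S66 f3a). [folklore] -/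
theorem compKer_cellBlock (lab : X → K) (G H : (X → ℝ) →ₗ[ℝ] (X → ℝ)) :
    compKer (cellBlock lab G) (cellBlock lab H) = cellBlock lab (G ∘ₗ H) := by
  funext e b
  unfold compKer cellBlock
  have hcomp : ∀ c, (Matrix.toEuclideanCLM (n := X) (𝕜 := ℂ) ((blockMat lab G e c).map Complex.ofReal)).comp
      (Matrix.toEuclideanCLM (n := X) (𝕜 := ℂ) ((blockMat lab H c b).map Complex.ofReal)) =
      Matrix.toEuclideanCLM (n := X) (𝕜 := ℂ) ((blockMat lab G e c * blockMat lab H c b).map Complex.ofReal) := by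
    intro c
    rw [← ContinuousLinearMap.mul_def, ← map_mul]
    congr 1
    ext i j
    simp only [Matrix.map_apply, Matrix.mul_apply, Complex.ofReal_sum, Complex.ofReal_mul]
  simp_rw [hcomp]
  rw [← map_sum, ← sum_blockMat_mul]
  congr 1
  ext i j
  simp only [Matrix.map_apply, Matrix.sum_apply, Complex.ofReal_sum]

/-! ## §3 E6 rows of cell blocks multiply -/

section Decay

variable {S : Type*}

/-- **E6 ROWS OF CELL BLOCKS MULTIPLY.**  Cells placed by `pos : K → 𝔖` with `dis ≥ 0` and the triangle inequality; E6 rows for the cell blocks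
of `G` (rate `δ₁`, constant `c₁ ≥ 0`) and of `H` (rate `δ₂`, constant `c₂ ≥ 0`); `0 ≤ δ ≤ δ₂` and the reduced-rate uniform cell sum
`∀ x, Σ_c e^{−(δ₁−δ)·dis(x, pos c)} ≤ M` ⟹ `‖cellBlock (G ∘ H) e b‖ ≤ c₁c₂M·e^{−δ·dis(pos e, pos b)}` for all cells `e b` — f1's `compKer_decay`
through `compKer_cellBlock`. [folklore] -/
theorem cellBlock_comp_decay (lab : X → K) (G H : (X → ℝ) →ₗ[ℝ] (X → ℝ)) (dis : S → S → ℝ) (pos : K → S)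
    (hdis : ∀ x y, 0 ≤ dis x y) (htri : ∀ x y z, dis x z ≤ dis x y + dis y z) {c₁ c₂ δ₁ δ₂ δ M : ℝ} (hc₁ : 0 ≤ c₁)
    (hc₂ : 0 ≤ c₂) (hδ : 0 ≤ δ) (hδ₂ : δ ≤ δ₂)
    (h₁ : ∀ e c, ‖cellBlock lab G e c‖ ≤ c₁ * Real.exp (-(δ₁ * dis (pos e) (pos c))))
    (h₂ : ∀ c b, ‖cellBlock lab H c b‖ ≤ c₂ * Real.exp (-(δ₂ * dis (pos c) (pos b))))
    (hM : ∀ x : S, ∑ c, Real.exp (-((δ₁ - δ) * dis x (pos c))) ≤ M) (e b : K) :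
    ‖cellBlock lab (G ∘ₗ H) e b‖ ≤ c₁ * c₂ * M * Real.exp (-(δ * dis (pos e) (pos b))) := by
  rw [← compKer_cellBlock]
  exact compKer_decay (cellBlock lab G) (cellBlock lab H) dis pos pos pos hdis htri hc₁ hc₂ hδ hδ₂ h₁ h₂ hM e b

end Decay

/-! ## §4 The scalar bridge: a matrix read as a kernel of multiplications (the `Beta/` ∕ `WRS` currency) -/

section Scalar

variable {𝕜 : Type*} [RCLike 𝕜] {Λ Λ' Λ'' : Type*}

/-- **The scalar kernel of a matrix**: entry `A c b` read as the multiplication map `𝕜 →L[𝕜] 𝕜` (DATA; the currency in which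
`B6KernelComposition.mul_decay`, `B13PerturbativeStep.WRS` and the `Beta/` matrix lemmas state E6-type rows). [folklore] -/
def scalarKer (A : Matrix Λ' Λ 𝕜) (c : Λ') (b : Λ) : 𝕜 →L[𝕜] 𝕜 := A c b • ContinuousLinearMap.id 𝕜 𝕜

/-- `‖scalarKer A c b‖ = ‖A c b‖`. [folklore] -/
theorem norm_scalarKer (A : Matrix Λ' Λ 𝕜) (c : Λ') (b : Λ) : ‖scalarKer A c b‖ = ‖A c b‖ := by
  rw [scalarKer, norm_smul, ContinuousLinearMap.norm_id, mul_one]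

/-- **SCALAR KERNELS MULTIPLY AS MATRICES**: `scalarKer A ⋆ scalarKer B = scalarKer (A * B)`. [folklore] -/
theorem compKer_scalarKer [Fintype Λ'] (A : Matrix Λ'' Λ' 𝕜) (B : Matrix Λ' Λ 𝕜) :
    compKer (scalarKer A) (scalarKer B) = scalarKer (A * B) := by
  funext e b
  simp only [compKer, scalarKer, Matrix.mul_apply, ContinuousLinearMap.smul_comp, ContinuousLinearMap.comp_smul,
    ContinuousLinearMap.id_comp, smul_smul, ← Finset.sum_smul]
  congr 1
  exact Finset.sum_congr rfl fun c _ => mul_comm _ _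

variable {S : Type*}

/-- **E6 ROWS OF MATRICES MULTIPLY** (any placed index sets; `B6KernelComposition.mul_decay`'s mechanism off `ℤᵈ`): entries of `A` and `B`
E6-localised at rates `δ₁, δ₂` (constants `c₁, c₂ ≥ 0`), `dis ≥ 0` with the triangle inequality, `0 ≤ δ ≤ δ₂`, reduced-rate uniform middle sum
`≤ M` ⟹ `‖(A * B) e b‖ ≤ c₁c₂M·e^{−δ·dis(pos″e, pos b)}` — f1's `compKer_decay` through `compKer_scalarKer`. [folklore] -/
theorem matrix_mul_decay [Fintype Λ'] (A : Matrix Λ'' Λ' 𝕜) (B : Matrix Λ' Λ 𝕜) (dis : S → S → ℝ) (pos'' : Λ'' → S)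
    (pos' : Λ' → S) (pos : Λ → S) (hdis : ∀ x y, 0 ≤ dis x y) (htri : ∀ x y z, dis x z ≤ dis x y + dis y z)
    {c₁ c₂ δ₁ δ₂ δ M : ℝ} (hc₁ : 0 ≤ c₁) (hc₂ : 0 ≤ c₂) (hδ : 0 ≤ δ) (hδ₂ : δ ≤ δ₂)
    (h₁ : ∀ e c, ‖A e c‖ ≤ c₁ * Real.exp (-(δ₁ * dis (pos'' e) (pos' c))))
    (h₂ : ∀ c b, ‖B c b‖ ≤ c₂ * Real.exp (-(δ₂ * dis (pos' c) (pos b))))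
    (hM : ∀ x : S, ∑ c, Real.exp (-((δ₁ - δ) * dis x (pos' c))) ≤ M) (e : Λ'') (b : Λ) :
    ‖(A * B) e b‖ ≤ c₁ * c₂ * M * Real.exp (-(δ * dis (pos'' e) (pos b))) := by
  rw [← norm_scalarKer, ← compKer_scalarKer]
  exact compKer_decay (scalarKer A) (scalarKer B) dis pos'' pos' pos hdis htri hc₁ hc₂ hδ hδ₂
    (fun e c => (norm_scalarKer A e c).le.trans (h₁ e c)) (fun c b => (norm_scalarKer B c b).le.trans (h₂ c b)) hM e b

end Scalar

end Summit.QuantumFields.BalabanUV.T4Continuum.ShellMeasureDecayKernelCompCells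

end
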